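import Literature.NumberTheory.Rogawski1990.TypeThreeCubicTorusNonsplit                 -- ★ `isRegularElt_iff_separable_localNonsplitEquiv`; brings ★ CMLocalNonsplitBorelTransport (`comap_localNonsplitEquiv_torusU`, `localNonsplitEquiv_apply_apply`)
import Literature.NumberTheory.Automorphic.UnitaryGroupIntegralPointsReductionInert      -- ★ `valuation_galAdicCompletionMap_eq`
import Literature.NumberTheory.Automorphic.UnitaryGroupInertPlaceHyperbolicBasis         -- ★ `galAdicCompletionMap_galAdicCompletionMap_of_smul_eq`
import HarnessLib

/-!
# F0 · P3c · line LH6 «StCharTS» — ROAD «JAC-LOC» brick (J6-T) «INPUT TRANSPORT»: set ∕ measure identities proved on the one-place MODEL `U(σ_w, Φ₃)(L_w)`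
# pull back to the CM carrier `U(Φ₃)(L⁺_v)` along `e = localNonsplitEquiv` (Platonov–Rapinchuk §5.1; Harish-Chandra 1970 Lemma 22)

Cell `pub/hodgecm-mathlib`, crux H413 = `stmt-HodgeConjecture-24833` (lane `--supports … --as helper`); seat LH6-p03 (g5), holder of the road «JAC-LOC»
(design note F0∕P3b 2026-09-02 «(J6) assembles on the CM carrier; (J6-T) transports the INPUTS»).  THEOREMS ONLY; no definition ∕ instance ∕ notation ∕ named
fact ∕ `sorry`.  HONEST LABEL: count-neutral plumbing; closes no organ.  HC_CM is proved only modulo the 7 printed citations (2 remaining: hLiu418 =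
`stmt-HodgeConjecture-24832`, h413 = `stmt-HodgeConjecture-24833`) until rung 0 closes.

WHY.  The orbit identity `Ad(K_γ)(s·T_γ) = s·P̃` (★ (J4c) p851809 ⊆, ★ (J5c) p851835 ⊇, glued by «ORBIT-TUBE-EQ») and the mass identity `ν(P̃) = c·ν(K_γ)` (★ (J4b)
`…SandwichMeasure`) are typed on the MODEL `U′ = U(σ, Φ₃)(K)`, `K` a non-archimedean local FIELD; the socket `hJacLoc` of ★ p851645 and the σ-trick ∕ π-system tools
of ★ (J1) p851761 live on the CM carrier `G = U(Φ₃)(L⁺_v) = ↥(unitaryGroupOfForm (c ⊗ 1) (cmLocalForm L 3 v))` over the RING `L ⊗ L⁺_v = ∏_{w ∣ v} L_w`.  At a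
non-split `v` (one place `w`) ★ `localNonsplitEquiv … w hw : G ≃ₜ* U(σ_w, Φ₃)(L_w)` is a topological isomorphism carrying the split torus `(cmBorelTriple L 3 v).M` onto
`torusU σ_w J_w` (★ `comap_localNonsplitEquiv_torusU`).  This file: (§1) a `MulEquiv` pulls an orbit identity `{k·e(s)·τ·k⁻¹} = e(s)·P′` back to
`{k·s·τ·k⁻¹ | k ∈ e⁻¹K′, τ ∈ e⁻¹K′ ∩ e⁻¹T′} = s·e⁻¹P′`; (§2) a `ContinuousMulEquiv` pulls a mass identity for ALL left-invariant measures back (`ν ↦ ν.map e`), and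
open ∕ compact ∕ neighbourhood-basis facts; (§3) the CM pins of the one-place model (`σ_w` involutive, isometric, continuous; `J_w = Φ₃`; diagonal writings and
regularity correspond); (§4) the CM-side heads in EXACTLY the hypothesis shapes `hOrb` ∕ `hP` of ★ (J6.5) p851860 `…TubeCosetIdentity.measure_tube_coset_eq`
(`H := (cmBorelTriple L 3 v).M`, `K := K′.comap e`, `P := P′.comap e`), with the model identities as hypotheses `hOrb′` ∕ `hP′` about ABSTRACT subgroups
`K′ P′` of the model (so the file does not depend on the binder lists of the model theorems that discharge them).

## References
* [PlatonovRapinchuk1994] V. Platonov, A. Rapinchuk, *Algebraic Groups and Number Theory* (1994), §5.1 (local points at a non-split place), §3.3.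
* [HarishChandra1970] Harish-Chandra, *Harmonic analysis on reductive p-adic groups*, LNM 162 (1970), Lemma 22.
* [Rogawski1990] J. D. Rogawski, *Automorphic Representations of Unitary Groups in Three Variables*, Ann. of Math. Stud. 123 (1990), §1.9–§1.10 pp. 8–9, §12.5 p. 182.
-/

set_option autoImplicit false
-- the mandated namespace has the single-problem summit's repeated segment (`HodgeConjecture.HodgeConjecture`)
set_option linter.dupNamespace false

noncomputable section

open MeasureTheory Measure Set Filter Topology
open scoped ENNReal NNReal Pointwise MatrixGroups
open Matrix ValuativeRel NumberField IsDedekindDomain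
open Literature.NumberTheory Literature.NumberTheory.Automorphic Literature.NumberTheory.Automorphic.UnitaryGroup Literature.NumberTheory.Rogawski1990

namespace Summit.HodgeConjecture.HodgeConjecture.Cruxes.H413.F0P3cStCharTSTubeModelTransport

/-! ## §1 Pull-back of orbit identities along a group isomorphism -/

section Algebra

variable {G G' : Type*} [Group G] [Group G'] (e : G ≃* G')

/-- `e⁻¹ {k·e(s)·τ·k⁻¹ | k ∈ K′, τ ∈ K′ ∩ T′} = {k·s·τ·k⁻¹ | k ∈ e⁻¹K′, τ ∈ e⁻¹K′ ∩ e⁻¹T′}`. [cite: PlatonovRapinchuk1994, §5.1] -/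
theorem preimage_setOf_conj_eq (K' T' : Subgroup G') (s : G) :
    e ⁻¹' {x' | ∃ k ∈ (K' : Set G'), ∃ τ ∈ (K' : Set G'), τ ∈ T' ∧ k * e s * τ * k⁻¹ = x'} =
      {x | ∃ k ∈ ((K'.comap e.toMonoidHom : Subgroup G) : Set G), ∃ τ ∈ ((K'.comap e.toMonoidHom : Subgroup G) : Set G),
        τ ∈ T'.comap e.toMonoidHom ∧ k * s * τ * k⁻¹ = x} := by
  ext x
  simp only [Set.mem_preimage, Set.mem_setOf_eq, SetLike.mem_coe, Subgroup.mem_comap, MulEquiv.coe_toMonoidHom]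
  constructor
  · rintro ⟨k', hk', τ', hτ', hτ'T, hx⟩
    refine ⟨e.symm k', by rwa [e.apply_symm_apply], e.symm τ', by rwa [e.apply_symm_apply], by rwa [e.apply_symm_apply], ?_⟩
    apply e.injective
    rw [map_mul, map_mul, map_mul, map_inv, e.apply_symm_apply, e.apply_symm_apply, hx]
  · rintro ⟨k, hk, τ, hτ, hτT, rfl⟩
    exact ⟨e k, hk, e τ, hτ, hτT, by rw [map_mul, map_mul, map_mul, map_inv]⟩

/-- `e⁻¹ (e(s) · P′) = s · e⁻¹P′`. [cite: PlatonovRapinchuk1994, §5.1] -/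
theorem preimage_smul_coe (P' : Subgroup G') (s : G) :
    e ⁻¹' (e s • (P' : Set G')) = s • ((P'.comap e.toMonoidHom : Subgroup G) : Set G) := by
  ext x
  simp only [Set.mem_preimage, Set.mem_smul_set, SetLike.mem_coe, Subgroup.mem_comap, MulEquiv.coe_toMonoidHom, smul_eq_mul]
  constructor
  · rintro ⟨p', hp', hx⟩
    refine ⟨e.symm p', by rwa [e.apply_symm_apply], ?_⟩
    apply e.injective
    rw [map_mul, e.apply_symm_apply, hx]
  · rintro ⟨p, hp, rfl⟩
    exact ⟨e p, hp, by rw [map_mul]⟩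

/-- **Orbit identity pulled back**: `{k·e(s)·τ·k⁻¹ | k ∈ K′, τ ∈ K′ ∩ T′} = e(s)·P′` on `G′` gives
`{k·s·τ·k⁻¹ | k ∈ e⁻¹K′, τ ∈ e⁻¹K′ ∩ e⁻¹T′} = s·e⁻¹P′` on `G`. [cite: PlatonovRapinchuk1994, §5.1] [cite: HarishChandra1970, Lemma 22] -/
theorem setOf_conj_eq_smul_of_map (K' T' P' : Subgroup G') (s : G)
    (h : {x' | ∃ k ∈ (K' : Set G'), ∃ τ ∈ (K' : Set G'), τ ∈ T' ∧ k * e s * τ * k⁻¹ = x'} = e s • (P' : Set G')) :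
    {x | ∃ k ∈ ((K'.comap e.toMonoidHom : Subgroup G) : Set G), ∃ τ ∈ ((K'.comap e.toMonoidHom : Subgroup G) : Set G),
        τ ∈ T'.comap e.toMonoidHom ∧ k * s * τ * k⁻¹ = x} = s • ((P'.comap e.toMonoidHom : Subgroup G) : Set G) := by
  rw [← preimage_setOf_conj_eq e K' T' s, h, preimage_smul_coe e P' s]

/-- A neighbourhood basis of `1` by subgroups pulls back to one (`e` a homeomorphism with `e 1 = 1`). [cite: PlatonovRapinchuk1994, §3.3] -/
theorem comap_basis_of_basis [TopologicalSpace G] [TopologicalSpace G'] (ec : G ≃ₜ* G') {ι : Type*} (K' : ι → Subgroup G')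
    (h : ∀ W' ∈ 𝓝 (1 : G'), ∃ n, ((K' n : Subgroup G') : Set G') ⊆ W') :
    ∀ W ∈ 𝓝 (1 : G), ∃ n, (((K' n).comap ec.toMulEquiv.toMonoidHom : Subgroup G) : Set G) ⊆ W := by
  intro W hW
  have h1 : (ec.symm : G' → G) 1 = 1 := map_one ec.symm
  have hW1 : W ∈ 𝓝 ((ec.symm : G' → G) 1) := by rwa [h1]
  have hW' : (ec.symm : G' → G) ⁻¹' W ∈ 𝓝 (1 : G') := ec.symm.continuous.continuousAt.preimage_mem_nhds hW1
  obtain ⟨n, hn⟩ := h _ hW'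
  refine ⟨n, fun x hx => ?_⟩
  have hx' : ec x ∈ ((K' n : Subgroup G') : Set G') := hx
  have hx'' : ec.symm (ec x) ∈ W := hn hx'
  rwa [ContinuousMulEquiv.symm_apply_apply] at hx''

end Algebra

/-! ## §2 Pull-back of mass identities along a topological group isomorphism -/

section TopologyTransport

variable {G G' : Type*} [Group G] [Group G'] [TopologicalSpace G] [TopologicalSpace G'] (e : G ≃ₜ* G')

/-- Open ∕ compact subgroups pull back to open ∕ compact subgroups along a topological group isomorphism. [cite: PlatonovRapinchuk1994, §3.3] -/
theorem isCompact_isOpen_comap_continuousMulEquiv (K' : Subgroup G') (hc : IsCompact (K' : Set G')) (ho : IsOpen (K' : Set G')) :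
    IsCompact ((K'.comap e.toMulEquiv.toMonoidHom : Subgroup G) : Set G) ∧ IsOpen ((K'.comap e.toMulEquiv.toMonoidHom : Subgroup G) : Set G) := by
  have hset : ((K'.comap e.toMulEquiv.toMonoidHom : Subgroup G) : Set G) = e ⁻¹' (K' : Set G') := rfl
  rw [hset]
  exact ⟨(e.toHomeomorph.isCompact_preimage).2 hc, ho.preimage e.continuous⟩

end TopologyTransport

section MeasureTransport

variable {G G' : Type*} [Group G] [Group G'] [TopologicalSpace G] [TopologicalSpace G']
  [MeasurableSpace G] [BorelSpace G] [MeasurableSpace G'] [BorelSpace G'] (e : G ≃ₜ* G')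

/-- `(ν.map e)(S′) = ν(e⁻¹ S′)` for EVERY set `S′` (`e` is a measurable equivalence). [folklore] -/
theorem map_apply_eq_preimage (ν : Measure G) (S' : Set G') : ν.map e S' = ν (e ⁻¹' S') := by
  let em : G ≃ᵐ G' :=
    { e.toMulEquiv.toEquiv with
      measurable_toFun := e.continuous.measurable
      measurable_invFun := e.symm.continuous.measurable }
  have hem : (em : G → G') = e := rfl
  rw [← hem, MeasurableEquiv.map_apply]

/-- `(ν.map e) ↑S′ = ν ↑(S′.comap e)` for a subgroup `S′`. [folklore] -/
theorem map_apply_coe_eq (ν : Measure G) (S' : Subgroup G') :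
    ν.map e (S' : Set G') = ν ((S'.comap e.toMulEquiv.toMonoidHom : Subgroup G) : Set G) := by
  rw [map_apply_eq_preimage]
  rfl

/-- `ν.map e` is left-invariant when `ν` is. [folklore] -/
theorem isMulLeftInvariant_map_of_continuousMulEquiv [IsTopologicalGroup G] [IsTopologicalGroup G'] (ν : Measure G) [ν.IsMulLeftInvariant] : (ν.map e).IsMulLeftInvariant :=
  isMulLeftInvariant_map (e.toMulEquiv : G →ₙ* G') e.continuous.measurable e.surjective

/-- **Mass identity pulled back**: if `ν′ ↑P′ = c · ν′ ↑K′` for EVERY left-invariant Borel measure `ν′` on `G′`, then `ν ↑(e⁻¹P′) = c · ν ↑(e⁻¹K′)` for every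
left-invariant Borel measure `ν` on `G`. [cite: HarishChandra1970, Lemma 22] [cite: PlatonovRapinchuk1994, §3.3] -/
theorem measure_comap_eq_of_forall_map [IsTopologicalGroup G] [IsTopologicalGroup G'] (K' P' : Subgroup G') (c : ℝ≥0∞)
    (h : ∀ ν' : Measure G', ν'.IsMulLeftInvariant → ν' (P' : Set G') = c * ν' (K' : Set G'))
    (ν : Measure G) [ν.IsMulLeftInvariant] :
    ν ((P'.comap e.toMulEquiv.toMonoidHom : Subgroup G) : Set G) = c * ν ((K'.comap e.toMulEquiv.toMonoidHom : Subgroup G) : Set G) := by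
  rw [← map_apply_coe_eq e ν P', ← map_apply_coe_eq e ν K']
  exact h _ (isMulLeftInvariant_map_of_continuousMulEquiv e ν)

end MeasureTransport

/-! ## §3 The CM pins of the one-place model at a non-split place -/

section CM

variable (L : Type) [Field L] [NumberField L] [IsCMField L] (v : HeightOneSpectrum (𝓞 ↥(maximalRealSubfield L)))
  (w : PlacesOver L v) (hw : IsCMField.complexConj L • w.1 = w.1)

/-- **The pins**: `σ_w ∘ σ_w = id`, `σ_w` isometric for `valuation L_w`, `σ_w` continuous, and `J_w = Φ₃ = (StdForm.antidiagonal 3).over L_w` — the hypotheses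
`hσ`, `hv`∕`hσv`, `hσc`, `hJ` of the model-side bricks (★ (J3) p851676, ★ (J4c) p851809, ★ (J5c) p851835, ★ (J4b)). [cite: Rogawski1990, §1.9 p. 8]
[cite: PlatonovRapinchuk1994, §5.1] -/
theorem model_pins :
    (∀ x, galAdicCompletionMap (L := L) (IsCMField.complexConj L) hw (galAdicCompletionMap (L := L) (IsCMField.complexConj L) hw x) = x) ∧
    (∀ x, valuation (w.1.adicCompletion L) (galAdicCompletionMap (L := L) (IsCMField.complexConj L) hw x) = valuation (w.1.adicCompletion L) x) ∧
    Continuous (galAdicCompletionMap (L := L) (IsCMField.complexConj L) hw) ∧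
    placeForm (Rogawski1990.qsForm L) w.1 = (StdForm.antidiagonal 3).over (w.1.adicCompletion L) := by
  refine ⟨galAdicCompletionMap_galAdicCompletionMap_of_smul_eq (IsCMField.complexConj L) w (IsCMField.complexConj_ne_one L) hw,
    fun x => valuation_galAdicCompletionMap_eq (IsCMField.complexConj L) v w hw x,
    continuous_galAdicCompletionMap L (IsCMField.complexConj L) hw, ?_⟩
  rw [placeForm, Rogawski1990.qsForm, antidiagOne_eq_over, StdForm.over_map]

/-- **Torus ↦ torus**: `e(s) ∈ torusU σ_w J_w` for `s ∈ (cmBorelTriple L 3 v).M`. [cite: Rogawski1990, §1.10 p. 9] [cite: PlatonovRapinchuk1994, §5.1] -/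
theorem localNonsplitEquiv_coe_mem_torusU (s : ↥(cmBorelTriple L 3 v).M) :
    localNonsplitEquiv (IsCMField.complexConj L) (Rogawski1990.qsForm L) (IsCMField.complexConj_ne_one L) w hw (s : ↥(unitaryGroupOfForm (conjLocal L (IsCMField.complexConj L) v) (cmLocalForm L 3 v))) ∈
      torusU (galAdicCompletionMap (L := L) (IsCMField.complexConj L) hw) (placeForm (Rogawski1990.qsForm L) w.1) :=
  (localNonsplitEquiv_mem_torusU_iff L v w hw (s : ↥(unitaryGroupOfForm (conjLocal L (IsCMField.complexConj L) v) (cmLocalForm L 3 v)))).2 s.2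

/-- **Diagonal writings correspond**: `diag(d) = s` on the CM carrier gives `diag(d_w) = e(s)` with `d_w i = (d i)(w)`. [cite: PlatonovRapinchuk1994, §5.1] -/
theorem glDiagonal_eval_eq_localNonsplitEquiv (s : ↥(unitaryGroupOfForm (conjLocal L (IsCMField.complexConj L) v) (cmLocalForm L 3 v))) {d : Fin 3 → (LocalRing L v)ˣ} (hd : glDiagonal 3 (LocalRing L v) d = (s : GL (Fin 3) (LocalRing L v))) :
    glDiagonal 3 (w.1.adicCompletion L) (fun i => Units.map (Pi.evalRingHom (fun w' : PlacesOver L v => w'.1.adicCompletion L) w).toMonoidHom (d i)) =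
      ((localNonsplitEquiv (IsCMField.complexConj L) (Rogawski1990.qsForm L) (IsCMField.complexConj_ne_one L) w hw s :
        ↥(unitaryGroupOfForm (galAdicCompletionMap (L := L) (IsCMField.complexConj L) hw) (placeForm (Rogawski1990.qsForm L) w.1))) :
          GL (Fin 3) (w.1.adicCompletion L)) := by
  apply Units.ext
  ext i j
  rw [localNonsplitEquiv_apply_apply L v w hw s i j, ← hd, coe_glDiagonal, coe_glDiagonal, Matrix.diagonal_apply, Matrix.diagonal_apply]
  split_ifs with h
  · rfl
  · rfl

omit [IsCMField L] in
/-- The root scalars of the two writings correspond: `(d_w i)⁻¹ d_w j − 1 = ((d i)⁻¹ d j − 1)(w)` (`d_w i = (d i)(w)`). [cite: PlatonovRapinchuk1994, §5.1] -/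
theorem rootScalar_eval_eq (d : Fin 3 → (LocalRing L v)ˣ) (i j : Fin 3) :
    (((Units.map (Pi.evalRingHom (fun w' : PlacesOver L v => w'.1.adicCompletion L) w).toMonoidHom (d i))⁻¹ *
        Units.map (Pi.evalRingHom (fun w' : PlacesOver L v => w'.1.adicCompletion L) w).toMonoidHom (d j) : (w.1.adicCompletion L)ˣ) :
          w.1.adicCompletion L) - 1 =
      ((((d i)⁻¹ * d j : (LocalRing L v)ˣ) : LocalRing L v) - 1) w := by
  rw [← map_inv, ← map_mul, Units.coe_map, Pi.sub_apply, Pi.one_apply]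
  rfl

/-- **Regular ↔ regular** across the one-place model (★ `isRegularElt_iff_separable_localNonsplitEquiv`). [cite: Rogawski1990, §3.1 p. 19] [cite: PlatonovRapinchuk1994, §5.1] -/
theorem isRegularElt_localNonsplitEquiv_iff (g : ↥(unitaryGroupOfForm (conjLocal L (IsCMField.complexConj L) v) (cmLocalForm L 3 v))) :
    IsRegularElt ((localNonsplitEquiv (IsCMField.complexConj L) (Rogawski1990.qsForm L) (IsCMField.complexConj_ne_one L) w hw g :
        ↥(unitaryGroupOfForm (galAdicCompletionMap (L := L) (IsCMField.complexConj L) hw) (placeForm (Rogawski1990.qsForm L) w.1))) :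
          GL (Fin 3) (w.1.adicCompletion L)) ↔
      IsRegularElt (g : GL (Fin 3) (LocalRing L v)) := by
  rw [isRegularElt_iff, TypeThreeTorus.isRegularElt_iff_separable_localNonsplitEquiv L w hw g]

/-- **`e⁻¹(torusU σ_w J_w) = (cmBorelTriple L 3 v).M`** in the `MulEquiv.toMonoidHom` spelling of §1–§2 (★ `comap_localNonsplitEquiv_torusU`). [cite: Rogawski1990, §1.10 p. 9] -/
theorem comap_torusU_eq_M :
    (torusU (galAdicCompletionMap (L := L) (IsCMField.complexConj L) hw) (placeForm (Rogawski1990.qsForm L) w.1)).comap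
        (localNonsplitEquiv (IsCMField.complexConj L) (Rogawski1990.qsForm L) (IsCMField.complexConj_ne_one L) w hw).toMulEquiv.toMonoidHom =
      (cmBorelTriple L 3 v).M := by
  ext g
  rw [Subgroup.mem_comap]
  exact localNonsplitEquiv_mem_torusU_iff L v w hw g

/-! ## §4 The CM-side heads in the shapes of ★ (J6.5) `measure_tube_coset_eq` -/

/-- **(J6-T) ORBIT IDENTITY ON THE CM CARRIER.**  If on the model `{k·e(s)·τ·k⁻¹ | k ∈ K′, τ ∈ K′ ∩ torusU} = e(s)·P′`, then on `G = U(Φ₃)(L⁺_v)`: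
`{k·s·τ·k⁻¹ | k ∈ K, τ ∈ K, τ ∈ (cmBorelTriple L 3 v).M} = s·P` with `K = e⁻¹K′`, `P = e⁻¹P′` — the hypothesis `hOrb` of ★ p851860. [cite: HarishChandra1970, Lemma 22]
[cite: PlatonovRapinchuk1994, §5.1] -/
theorem cm_setOf_conj_eq_smul
    (K' P' : Subgroup ↥(unitaryGroupOfForm (galAdicCompletionMap (L := L) (IsCMField.complexConj L) hw) (placeForm (Rogawski1990.qsForm L) w.1)))
    (s : ↥(cmBorelTriple L 3 v).M)
    (hOrb' : {x' | ∃ k ∈ (K' : Set _), ∃ τ ∈ (K' : Set _),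
        τ ∈ torusU (galAdicCompletionMap (L := L) (IsCMField.complexConj L) hw) (placeForm (Rogawski1990.qsForm L) w.1) ∧
          k * localNonsplitEquiv (IsCMField.complexConj L) (Rogawski1990.qsForm L) (IsCMField.complexConj_ne_one L) w hw (s : ↥(unitaryGroupOfForm (conjLocal L (IsCMField.complexConj L) v) (cmLocalForm L 3 v))) * τ * k⁻¹ = x'} =
      localNonsplitEquiv (IsCMField.complexConj L) (Rogawski1990.qsForm L) (IsCMField.complexConj_ne_one L) w hw (s : ↥(unitaryGroupOfForm (conjLocal L (IsCMField.complexConj L) v) (cmLocalForm L 3 v))) • (P' : Set _)) :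
    {x : ↥(unitaryGroupOfForm (conjLocal L (IsCMField.complexConj L) v) (cmLocalForm L 3 v)) | ∃ k ∈ ((K'.comap (localNonsplitEquiv (IsCMField.complexConj L) (Rogawski1990.qsForm L) (IsCMField.complexConj_ne_one L) w hw).toMulEquiv.toMonoidHom :
          Subgroup ↥(unitaryGroupOfForm (conjLocal L (IsCMField.complexConj L) v) (cmLocalForm L 3 v))) : Set ↥(unitaryGroupOfForm (conjLocal L (IsCMField.complexConj L) v) (cmLocalForm L 3 v))),
        ∃ τ ∈ ((K'.comap (localNonsplitEquiv (IsCMField.complexConj L) (Rogawski1990.qsForm L) (IsCMField.complexConj_ne_one L) w hw).toMulEquiv.toMonoidHom :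
          Subgroup ↥(unitaryGroupOfForm (conjLocal L (IsCMField.complexConj L) v) (cmLocalForm L 3 v))) : Set ↥(unitaryGroupOfForm (conjLocal L (IsCMField.complexConj L) v) (cmLocalForm L 3 v))),
          τ ∈ (cmBorelTriple L 3 v).M ∧ k * (s : ↥(unitaryGroupOfForm (conjLocal L (IsCMField.complexConj L) v) (cmLocalForm L 3 v))) * τ * k⁻¹ = x} =
      (s : ↥(unitaryGroupOfForm (conjLocal L (IsCMField.complexConj L) v) (cmLocalForm L 3 v))) • ((P'.comap (localNonsplitEquiv (IsCMField.complexConj L) (Rogawski1990.qsForm L) (IsCMField.complexConj_ne_one L) w hw).toMulEquiv.toMonoidHom :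
        Subgroup ↥(unitaryGroupOfForm (conjLocal L (IsCMField.complexConj L) v) (cmLocalForm L 3 v))) : Set ↥(unitaryGroupOfForm (conjLocal L (IsCMField.complexConj L) v) (cmLocalForm L 3 v))) := by
  have h := setOf_conj_eq_smul_of_map
    (localNonsplitEquiv (IsCMField.complexConj L) (Rogawski1990.qsForm L) (IsCMField.complexConj_ne_one L) w hw).toMulEquiv K'
    (torusU (galAdicCompletionMap (L := L) (IsCMField.complexConj L) hw) (placeForm (Rogawski1990.qsForm L) w.1)) P'
    (s : ↥(unitaryGroupOfForm (conjLocal L (IsCMField.complexConj L) v) (cmLocalForm L 3 v))) hOrb'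
  ext x
  have hx := Set.ext_iff.1 h x
  constructor
  · rintro ⟨k, hk, τ, hτ, hτT, hkx⟩
    exact hx.1 ⟨k, hk, τ, hτ, Subgroup.mem_comap.2 ((localNonsplitEquiv_mem_torusU_iff L v w hw τ).2 hτT), hkx⟩
  · intro hmem
    obtain ⟨k, hk, τ, hτ, hτT, hkx⟩ := hx.2 hmem
    exact ⟨k, hk, τ, hτ, (localNonsplitEquiv_mem_torusU_iff L v w hw τ).1 (Subgroup.mem_comap.1 hτT), hkx⟩

/-- **(J6-T) MASS IDENTITY ON THE CM CARRIER.**  If `ν′ ↑P′ = c · ν′ ↑K′` for every left-invariant Borel `ν′` on the model (★ (J4b) is stated for every such `ν′`),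
then `ν ↑(e⁻¹P′) = c · ν ↑(e⁻¹K′)` for every left-invariant Borel `ν` on `G = U(Φ₃)(L⁺_v)` — the hypothesis `hP` of ★ p851860.
[cite: HarishChandra1970, Lemma 22] [cite: PlatonovRapinchuk1994, §3.3] -/
theorem cm_measure_comap_eq
    [MeasurableSpace ↥(unitaryGroupOfForm (conjLocal L (IsCMField.complexConj L) v) (cmLocalForm L 3 v))] [BorelSpace ↥(unitaryGroupOfForm (conjLocal L (IsCMField.complexConj L) v) (cmLocalForm L 3 v))]
    [MeasurableSpace ↥(unitaryGroupOfForm (galAdicCompletionMap (L := L) (IsCMField.complexConj L) hw) (placeForm (Rogawski1990.qsForm L) w.1))]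
    [BorelSpace ↥(unitaryGroupOfForm (galAdicCompletionMap (L := L) (IsCMField.complexConj L) hw) (placeForm (Rogawski1990.qsForm L) w.1))]
    (K' P' : Subgroup ↥(unitaryGroupOfForm (galAdicCompletionMap (L := L) (IsCMField.complexConj L) hw) (placeForm (Rogawski1990.qsForm L) w.1)))
    (c : ℝ≥0∞)
    (hP' : ∀ ν' : Measure ↥(unitaryGroupOfForm (galAdicCompletionMap (L := L) (IsCMField.complexConj L) hw) (placeForm (Rogawski1990.qsForm L) w.1)),
      ν'.IsMulLeftInvariant → ν' (P' : Set _) = c * ν' (K' : Set _))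
    (ν : Measure ↥(unitaryGroupOfForm (conjLocal L (IsCMField.complexConj L) v) (cmLocalForm L 3 v))) [ν.IsMulLeftInvariant] :
    ν ((P'.comap (localNonsplitEquiv (IsCMField.complexConj L) (Rogawski1990.qsForm L) (IsCMField.complexConj_ne_one L) w hw).toMulEquiv.toMonoidHom :
        Subgroup ↥(unitaryGroupOfForm (conjLocal L (IsCMField.complexConj L) v) (cmLocalForm L 3 v))) : Set ↥(unitaryGroupOfForm (conjLocal L (IsCMField.complexConj L) v) (cmLocalForm L 3 v))) =
      c * ν ((K'.comap (localNonsplitEquiv (IsCMField.complexConj L) (Rogawski1990.qsForm L) (IsCMField.complexConj_ne_one L) w hw).toMulEquiv.toMonoidHom :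
        Subgroup ↥(unitaryGroupOfForm (conjLocal L (IsCMField.complexConj L) v) (cmLocalForm L 3 v))) : Set ↥(unitaryGroupOfForm (conjLocal L (IsCMField.complexConj L) v) (cmLocalForm L 3 v))) := by
  -- the instances on the `«local»` spelling of the carrier (the domain of `e`), definitionally those given
  letI : MeasurableSpace ↥(«local» L (IsCMField.complexConj L) 3 (Rogawski1990.qsForm L) v) := ‹MeasurableSpace ↥(unitaryGroupOfForm (conjLocal L (IsCMField.complexConj L) v) (cmLocalForm L 3 v))›
  haveI : BorelSpace ↥(«local» L (IsCMField.complexConj L) 3 (Rogawski1990.qsForm L) v) := ‹BorelSpace ↥(unitaryGroupOfForm (conjLocal L (IsCMField.complexConj L) v) (cmLocalForm L 3 v))›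
  haveI : (show Measure ↥(«local» L (IsCMField.complexConj L) 3 (Rogawski1990.qsForm L) v) from ν).IsMulLeftInvariant := ‹ν.IsMulLeftInvariant›
  exact measure_comap_eq_of_forall_map (localNonsplitEquiv (IsCMField.complexConj L) (Rogawski1990.qsForm L) (IsCMField.complexConj_ne_one L) w hw) K' P' c hP'
    (show Measure ↥(«local» L (IsCMField.complexConj L) 3 (Rogawski1990.qsForm L) v) from ν)

/-- **(J6-T) LEVELS ON THE CM CARRIER**: `e⁻¹K′` is compact open when `K′` is (e.g. `K′ = K_γ ∩ U′`, ★ `isCompact_isOpen_comap_congruenceGL`), and a neighbourhood basis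
`(K′ₙ)` of `1` pulls back to one — the `hKo` ∕ `hKc` of ★ p851860 and the `hK` clause of ★ p851737. [cite: PlatonovRapinchuk1994, §3.3] -/
theorem cm_levels
    (K' : Subgroup ↥(unitaryGroupOfForm (galAdicCompletionMap (L := L) (IsCMField.complexConj L) hw) (placeForm (Rogawski1990.qsForm L) w.1)))
    (hc : IsCompact (K' : Set ↥(unitaryGroupOfForm (galAdicCompletionMap (L := L) (IsCMField.complexConj L) hw) (placeForm (Rogawski1990.qsForm L) w.1)))) (ho : IsOpen (K' : Set ↥(unitaryGroupOfForm (galAdicCompletionMap (L := L) (IsCMField.complexConj L) hw) (placeForm (Rogawski1990.qsForm L) w.1))))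
    {ι : Type*} (Kn : ι → Subgroup ↥(unitaryGroupOfForm (galAdicCompletionMap (L := L) (IsCMField.complexConj L) hw) (placeForm (Rogawski1990.qsForm L) w.1)))
    (hbasis : ∀ W' ∈ 𝓝 (1 : ↥(unitaryGroupOfForm (galAdicCompletionMap (L := L) (IsCMField.complexConj L) hw) (placeForm (Rogawski1990.qsForm L) w.1))),
      ∃ n, ((Kn n : Subgroup ↥(unitaryGroupOfForm (galAdicCompletionMap (L := L) (IsCMField.complexConj L) hw) (placeForm (Rogawski1990.qsForm L) w.1))) : Set ↥(unitaryGroupOfForm (galAdicCompletionMap (L := L) (IsCMField.complexConj L) hw) (placeForm (Rogawski1990.qsForm L) w.1))) ⊆ W') :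
    (IsCompact ((K'.comap (localNonsplitEquiv (IsCMField.complexConj L) (Rogawski1990.qsForm L) (IsCMField.complexConj_ne_one L) w hw).toMulEquiv.toMonoidHom :
        Subgroup ↥(unitaryGroupOfForm (conjLocal L (IsCMField.complexConj L) v) (cmLocalForm L 3 v))) : Set ↥(unitaryGroupOfForm (conjLocal L (IsCMField.complexConj L) v) (cmLocalForm L 3 v))) ∧
      IsOpen ((K'.comap (localNonsplitEquiv (IsCMField.complexConj L) (Rogawski1990.qsForm L) (IsCMField.complexConj_ne_one L) w hw).toMulEquiv.toMonoidHom :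
        Subgroup ↥(unitaryGroupOfForm (conjLocal L (IsCMField.complexConj L) v) (cmLocalForm L 3 v))) : Set ↥(unitaryGroupOfForm (conjLocal L (IsCMField.complexConj L) v) (cmLocalForm L 3 v)))) ∧
      ∀ W ∈ 𝓝 (1 : ↥(unitaryGroupOfForm (conjLocal L (IsCMField.complexConj L) v) (cmLocalForm L 3 v))), ∃ n, (((Kn n).comap (localNonsplitEquiv (IsCMField.complexConj L) (Rogawski1990.qsForm L) (IsCMField.complexConj_ne_one L) w hw).toMulEquiv.toMonoidHom :
        Subgroup ↥(unitaryGroupOfForm (conjLocal L (IsCMField.complexConj L) v) (cmLocalForm L 3 v))) : Set ↥(unitaryGroupOfForm (conjLocal L (IsCMField.complexConj L) v) (cmLocalForm L 3 v))) ⊆ W :=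
  ⟨isCompact_isOpen_comap_continuousMulEquiv (localNonsplitEquiv (IsCMField.complexConj L) (Rogawski1990.qsForm L) (IsCMField.complexConj_ne_one L) w hw) K' hc ho,
    comap_basis_of_basis (localNonsplitEquiv (IsCMField.complexConj L) (Rogawski1990.qsForm L) (IsCMField.complexConj_ne_one L) w hw) Kn hbasis⟩

end CM

end Summit.HodgeConjecture.HodgeConjecture.Cruxes.H413.F0P3cStCharTSTubeModelTransport

end
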